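import Summits.QuantumFields.YangMills.Theorems.BalabanLadderNTLinkVarianceFloor
import Summits.QuantumFields.YangMills.Theorems.BalabanLadderNTOnePointFloor
import Summits.QuantumFields.YangMills.Theorems.BalabanLadderNTSharpPlaquetteMoments
import HarnessLib

/-!
# Crux `NT` (stmt-QuantumFields-19353): the one-link KERNEL variance floor on good exteriors, and the torus plumbing
# (good exteriors are typical; a kernel floor integrates to a torus floor) — hypothesis-free

Fleet lead prover of crux `NT` (unit `ym-spine-19353-p1`, g30).  Sequel of `Theorems/BalabanLadderNTLinkVarianceFloor` (the
one-link variance floor `linkCost_variance_floor`), run through the tree's DLR plumbing exactly as g9 ran the equipartition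
floor (`Theorems/BalabanLadderNTOnePointFloor`):

* §1 **kernel form** (`kernel_integral_eq_div`, `kernel_variance_floor`, `kernel_variance_floor_plaquette`): for every dimension
  `d`, every link `e` and every exterior `ω` whose link action is `θ/β`-SMALL (`S_e(ω) ≤ θ/β`: the staples around `e` are
  consistent, as seen from the actual value `ω_e` of the link) and whose one-link kernel does not overheat the link
  (`∫ S_e dγ_e(·|ω) ≤ C/β`), every observable `F` that is affine in the link through a family `k'` of group elements
  (`F(ω^{e ← g}) = u_{k'}(g) + K`; e.g. ONE plaquette cost through `e`, `sub_plaquetteObs_update_eq_linkCost`, or `S_e` itself)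
  has kernel variance `∫ (F − c)² dγ_e(·|ω) ≥ κ/β²` for EVERY `c`, all `β ≥ β₀` — the TYPICAL-EXTERIOR form of a floor (idea
  card `typical-exterior-floor`, here at the one-link level);
* §2 **torus plumbing**, `d = 4`: the GOOD exteriors (both smallness conditions at `θ = 24K + 1`, `K` = g28's sharp one-point
  constant `⟨φ⟩_{T,β} ≤ K/β`, `SharpCeilings.exists_plaquetteCost_moments_le_sharp`) have torus probability `≥ 1/2` on every
  odd torus `2L+1 ≥ 5` at every `β ≥ 4` (`exists_good_exteriors`: torus DLR for `S_e` + Markov twice), and a kernel floor on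
  the good exteriors integrates to a torus floor (`torus_integral_ge_of_good`).

The sequel `Theorems/BalabanLadderNTTwoPointFloor` concludes `c/β² ≤ Var_{T,β}(φ_q)` uniformly in the volume.
HONEST FRAMING.  DLR bookkeeping over a lattice-scale conditional variance floor (tree-level perturbation theory made rigorous);
nothing at NT's physical scale `a(β)⁻¹`, nothing about the seam or the gap; NT is NOT proved; not Clay.
Refs: Seiler LNP 159 Ch. 2 (DLR); Georgii 2011 Def. 2.9; Montvay–Münster 1994 §3.2.
-/

set_option autoImplicit false

noncomputable section

open scoped Matrix Matrix.Norms.Frobenius ENNReal NNReal Topology BigOperators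
open MeasureTheory Measure Filter Set ProbabilityTheory
open Literature.MathematicalPhysics.QuantumLattice
open Literature.MathematicalPhysics.QuantumFieldTheory hiding ZdEdge
open Literature.Probability.LatticeModels (glueWith glueWith_apply_mem glueWith_apply_not_mem)
open Summit.QuantumFields.YangMills.Theorems.FreeEnergyLogCoefficient (dimE)
open Summit.QuantumFields.YangMills.Theorems.OSLegsFromFemtoAndGap.StubLower (integral_torusLift_eq_integral_kernel
  exists_near_of_mem_plaquetteEdges_touching)
open Literature.MathematicalPhysics.QuantumFieldTheory.WilsonRP (plaqRe abs_plaqRe_le measurable_plaqRe)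

namespace Summit.QuantumFields.YangMills.Cruxes.NT.LinkEquipartition

/-! ## §1 The one-link kernel: ratio identity and the variance floor on good exteriors -/

section Kernel

variable {N : ℕ} {G : Type*} [Group G] [TopologicalSpace G] [IsTopologicalGroup G] [CompactSpace G]
  [MeasurableSpace G] [BorelSpace G] [SecondCountableTopology G] (ρ : G →* Matrix (Fin N) (Fin N) ℂ)

/-- **The one-link kernel as a ratio of tilted Haar integrals**, for a general measurable observable:
`∫ F dγ_{e}(·|ω) = (∫ F(ω^{e ← g}) e^{−β u_ω(g)} dσ(g)) / (∫ e^{−β u_ω} dσ)`, `u_ω = linkCost ρ (staples of ω at e)`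
(tree `integral_ymSpecification`; on the one-point index set gluing is `update ω e ∘ eval`). [folklore] -/
theorem kernel_integral_eq_div {d : ℕ} [DecidableEq (ZdEdge d)] (hρ : Continuous ρ)
    (hU : ∀ g, ρ g ∈ Matrix.unitaryGroup (Fin N) ℂ) (β : ℝ) (e : ZdEdge d) (ω : LGConfig d G)
    {F : LGConfig d G → ℝ} (hF : Measurable F) :
    ∫ U, F U ∂(ymSpecification ρ β {e} ω) =
      (∫ g, F (Function.update ω e g) *
          Real.exp (-β * linkCost ρ (fun p : ↥(plaquettesTouching {e}) => staple p.1 e ω) g) ∂(haarProbability G)) /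
        ∫ g, Real.exp (-β * linkCost ρ (fun p : ↥(plaquettesTouching {e}) => staple p.1 e ω) g) ∂(haarProbability G) := by
  set k : ↥(plaquettesTouching {e}) → G := fun p => staple p.1 e ω with hk
  rw [integral_ymSpecification ρ hρ β {e} hF ω]
  set ev : (↥({e} : Finset (ZdEdge d)) → G) → G := fun ζ => ζ ⟨e, Finset.mem_singleton_self e⟩ with hev
  have hgl : ∀ ζ : ↥({e} : Finset (ZdEdge d)) → G, glueWith {e} ζ ω = Function.update ω e (ev ζ) := by
    intro ζ
    funext z
    by_cases hz : z = e
    · subst hz; simp [hev]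
    · rw [Function.update_of_ne hz, glueWith_apply_not_mem _ _ _ (by simpa using hz)]
  have hmap : (Measure.pi fun _ : ↥({e} : Finset (ZdEdge d)) => haarProbability G).map ev = haarProbability G :=
    (MeasureTheory.measurePreserving_eval (fun _ : ↥({e} : Finset (ZdEdge d)) => haarProbability G)
      ⟨e, Finset.mem_singleton_self e⟩).map_eq
  have hevm : Measurable ev := measurable_pi_apply _
  have hu : ∀ g, wilsonBoundaryAction ρ {e} (Function.update ω e g) = linkCost ρ k g :=
    fun g => wilsonBoundaryAction_update_eq_linkCost ρ hU e ω g
  have hcu : Continuous (linkCost ρ k) := continuous_linkCost ρ hρ k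
  set F₁ : G → ℝ := fun g => F (Function.update ω e g) * Real.exp (-β * linkCost ρ k g) with hF₁
  set F₂ : G → ℝ := fun g => Real.exp (-β * linkCost ρ k g) with hF₂
  set π : Measure (↥({e} : Finset (ZdEdge d)) → G) := Measure.pi fun _ => haarProbability G with hπ
  have e1 : (fun ζ : ↥({e} : Finset (ZdEdge d)) → G =>
      F (glueWith {e} ζ ω) * Real.exp (-β * wilsonBoundaryAction ρ {e} (glueWith {e} ζ ω))) = fun ζ => F₁ (ev ζ) := by
    funext ζ; simp only [hF₁, hgl, hu]
  have e2 : (fun ζ : ↥({e} : Finset (ZdEdge d)) → G => Real.exp (-β * wilsonBoundaryAction ρ {e} (glueWith {e} ζ ω))) =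
      fun ζ => F₂ (ev ζ) := by
    funext ζ; simp only [hF₂, hgl, hu]
  have hm1 : Measurable F₁ :=
    (hF.comp (measurable_update ω)).mul (Real.continuous_exp.comp (continuous_const.mul hcu)).measurable
  have hm2 : Measurable F₂ := (Real.continuous_exp.comp (continuous_const.mul hcu)).measurable
  have H1 : ∫ ζ, F₁ (ev ζ) ∂π = ∫ g, F₁ g ∂(haarProbability G) := by
    have h := integral_map (μ := π) hevm.aemeasurable (hm1.aestronglyMeasurable (μ := π.map ev))
    rw [hmap] at h
    exact h.symm
  have H2 : ∫ ζ, F₂ (ev ζ) ∂π = ∫ g, F₂ g ∂(haarProbability G) := by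
    have h := integral_map (μ := π) hevm.aemeasurable (hm2.aestronglyMeasurable (μ := π.map ev))
    rw [hmap] at h
    exact h.symm
  rw [e1, e2, H1, H2]

/-- **THE ONE-LINK KERNEL VARIANCE FLOOR ON GOOD EXTERIORS.**  For a compact group with a faithful continuous unitary
representation `ρ` of positive Lie dimension and every `θ ≥ 0`, `C`, `m₀` there are `κ, β₀ > 0` such that for every `β ≥ β₀`,
every dimension `d`, every link `e` lying on `1 ≤ #plaquettes ≤ m₀`, and every exterior `ω` with SMALL LINK ACTION
`S_e(ω) ≤ θ/β` and kernel mean `∫ S_e dγ_e(·|ω) ≤ C/β`: every measurable observable `F` that is affine in the link through a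
non-empty family `k'` of `≤ m₀` group elements, `θ/β`-consistent at `ω_e` (`F(ω^{e ← g}) = u_{k'}(g) + K`, `u_{k'}(ω_e) ≤ θ/β`),
has `κ/β² ≤ ∫ (F − c)² dγ_e(·|ω)` for EVERY real `c`. [folklore] -/
theorem kernel_variance_floor (hρ : Continuous ρ) (hinj : Function.Injective ρ)
    (hU : ∀ g, ρ g ∈ Matrix.unitaryGroup (Fin N) ℂ) (hD : 0 < dimE ρ) {θ : ℝ} (C : ℝ) (hθ : 0 ≤ θ) (m₀ : ℕ) :
    ∃ κ β₀ : ℝ, 0 < κ ∧ 0 < β₀ ∧ ∀ β : ℝ, β₀ ≤ β → ∀ {d : ℕ} (e : ZdEdge d) (ω : LGConfig d G),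
      (plaquettesTouching {e}).Nonempty → (plaquettesTouching {e}).card ≤ m₀ →
      ∀ (ι' : Type) [Fintype ι'] [Nonempty ι'] (k' : ι' → G), Fintype.card ι' ≤ m₀ →
      ∀ (F : LGConfig d G → ℝ) (K : ℝ), Measurable F →
        (∀ g, F (Function.update ω e g) = linkCost ρ k' g + K) →
        wilsonBoundaryAction ρ {e} ω ≤ θ / β → linkCost ρ k' (ω e) ≤ θ / β →
        ∫ U, wilsonBoundaryAction ρ {e} U ∂(ymSpecification ρ β {e} ω) ≤ C / β →
        ∀ c : ℝ, κ / β ^ 2 ≤ ∫ U, (F U - c) ^ 2 ∂(ymSpecification ρ β {e} ω) := by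
  classical
  obtain ⟨κ, β₀, hκ, hβ₀, hfloor⟩ := linkCost_variance_floor ρ hρ hinj hU hD C hθ m₀
  refine ⟨κ, β₀, hκ, hβ₀, fun β hβ d e ω hne hcard ι' _ _ k' hk' F K hF hFk hS hk'0 hmean c => ?_⟩
  haveI : Nonempty ↥(plaquettesTouching {e}) := hne.coe_sort
  set k : ↥(plaquettesTouching {e}) → G := fun p => staple p.1 e ω with hk
  have hβ0 : 0 < β := hβ₀.trans_le hβ
  -- the normaliser is positive
  have hcu : Continuous (linkCost ρ k) := continuous_linkCost ρ hρ k
  set w : G → ℝ := fun g => Real.exp (-β * linkCost ρ k g) with hw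
  have hwcont : Continuous w := Real.continuous_exp.comp (continuous_const.mul hcu)
  have hwint : Integrable w (haarProbability G) :=
    hwcont.integrable_of_hasCompactSupport (HasCompactSupport.of_compactSpace _)
  have hZpos : 0 < ∫ g, w g ∂(haarProbability G) := by
    obtain ⟨B, hB⟩ : ∃ B, ∀ h, |linkCost ρ k h| ≤ B := by
      obtain ⟨B, hB⟩ := (isCompact_univ.image hcu).isBounded.exists_norm_le
      exact ⟨B, fun h => hB _ ⟨h, Set.mem_univ _, rfl⟩⟩
    have hle : ∀ g, Real.exp (-β * B) ≤ w g := fun g =>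
      Real.exp_le_exp.2 (by nlinarith [le_abs_self (linkCost ρ k g), hB g])
    calc (0 : ℝ) < Real.exp (-β * B) := Real.exp_pos _
      _ = ∫ _g, Real.exp (-β * B) ∂(haarProbability G) := by simp
      _ ≤ _ := integral_mono (integrable_const _) hwint hle
  -- the kernel-mean hypothesis in ratio form
  have hmean' : ∫ h, linkCost ρ k h * Real.exp (-β * linkCost ρ k h) ∂(haarProbability G) ≤
      C / β * ∫ h, Real.exp (-β * linkCost ρ k h) ∂(haarProbability G) := by
    rw [kernel_linkAction_eq_div ρ hρ hU β e ω, div_le_iff₀ hZpos] at hmean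
    exact hmean
  -- the base point is the actual value of the link
  have hk0 : linkCost ρ k (ω e) ≤ θ / β := by
    rw [← wilsonBoundaryAction_update_eq_linkCost ρ hU e ω (ω e), Function.update_eq_self]
    exact hS
  have hcard' : Fintype.card ↥(plaquettesTouching {e}) ≤ m₀ := by rwa [Fintype.card_coe]
  have hmain := hfloor β hβ ↥(plaquettesTouching {e}) k hcard' ι' k' hk' (ω e) hk0 hk'0 hmean' (c - K)
  -- the observable in ratio form
  have hFm : Measurable fun U => (F U - c) ^ 2 := (hF.sub measurable_const).pow_const 2
  rw [kernel_integral_eq_div ρ hρ hU β e ω hFm, le_div_iff₀ hZpos]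
  have e1 : (fun g => (F (Function.update ω e g) - c) ^ 2 * Real.exp (-β * linkCost ρ k g)) =
      fun g => (linkCost ρ k' g - (c - K)) ^ 2 * Real.exp (-β * linkCost ρ k g) := by
    funext g; rw [hFk g]; ring
  rw [e1]
  exact hmain

omit [TopologicalSpace G] [IsTopologicalGroup G] [CompactSpace G] [MeasurableSpace G] [BorelSpace G]
  [SecondCountableTopology G] in
/-- **One plaquette through the link is affine in the link**: for `e ∈ p`,
`N − Re tr ρ(U_p(ω^{e ← g})) = u_{k'}(g)` with the one-element staple family `k' = (staple_p^e(ω))`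
(tree `re_trace_holonomy_update`). [folklore] -/
theorem sub_plaquetteObs_update_eq_linkCost {d : ℕ} [DecidableEq (ZdEdge d)]
    (hU : ∀ g, ρ g ∈ Matrix.unitaryGroup (Fin N) ℂ) {p : ZdPlaquette d} {e : ZdEdge d} (hep : e ∈ plaquetteEdges p)
    (ω : LGConfig d G) (g : G) :
    (N : ℝ) - plaquetteObs ρ p.1 p.2.1.1 p.2.1.2 (Function.update ω e g) =
      linkCost ρ (fun _ : Unit => staple p e ω) g + 0 := by
  rw [add_zero, linkCost, plaquetteObs, re_trace_holonomy_update ρ hU hep ω g]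
  simp only [Finset.univ_unique, Finset.sum_singleton, map_mul]

omit [TopologicalSpace G] [IsTopologicalGroup G] [CompactSpace G] [MeasurableSpace G] [BorelSpace G]
  [SecondCountableTopology G] in
/-- One plaquette cost through the link is at most the link action `S_e` (all costs are non-negative). [folklore] -/
theorem sub_plaquetteObs_le_linkAction {d : ℕ} (hU : ∀ g, ρ g ∈ Matrix.unitaryGroup (Fin N) ℂ)
    {p : ZdPlaquette d} {e : ZdEdge d} (hep : e ∈ plaquetteEdges p) (ω : LGConfig d G) :
    (N : ℝ) - plaquetteObs ρ p.1 p.2.1.1 p.2.1.2 ω ≤ wilsonBoundaryAction ρ {e} ω := by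
  unfold wilsonBoundaryAction
  refine Finset.single_le_sum (f := fun p' : ZdPlaquette d => (N : ℝ) - plaquetteObs ρ p'.1 p'.2.1.1 p'.2.1.2 ω)
    (fun p' _ => ?_) (mem_plaquettesTouching_singleton.2 hep)
  have h := abs_le.1 (abs_plaquetteObs_le_holds ρ hU p'.1 p'.2.1.1 p'.2.1.2 ω)
  linarith [h.2]

/-- **Kernel variance floor for ONE plaquette through the link, on good exteriors**: `κ/β² ≤ ∫ (φ_p − c)² dγ_e(·|ω)` for every
`c`, every `β ≥ β₀`, every link `e ∈ p` on `≤ m₀` plaquettes and every exterior `ω` with `S_e(ω) ≤ θ/β` and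
`∫ S_e dγ_e(·|ω) ≤ θ/β`. [folklore] -/
theorem kernel_variance_floor_plaquette (hρ : Continuous ρ) (hinj : Function.Injective ρ)
    (hU : ∀ g, ρ g ∈ Matrix.unitaryGroup (Fin N) ℂ) (hD : 0 < dimE ρ) {θ : ℝ} (hθ : 0 ≤ θ) (m₀ : ℕ) (hm₀ : 1 ≤ m₀) :
    ∃ κ β₀ : ℝ, 0 < κ ∧ 0 < β₀ ∧ ∀ β : ℝ, β₀ ≤ β → ∀ {d : ℕ} (p : ZdPlaquette d) (e : ZdEdge d) (ω : LGConfig d G),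
      e ∈ plaquetteEdges p → (plaquettesTouching {e}).card ≤ m₀ →
      wilsonBoundaryAction ρ {e} ω ≤ θ / β →
      ∫ U, wilsonBoundaryAction ρ {e} U ∂(ymSpecification ρ β {e} ω) ≤ θ / β →
      ∀ c : ℝ, κ / β ^ 2 ≤ ∫ U, (((N : ℝ) - plaquetteObs ρ p.1 p.2.1.1 p.2.1.2 U) - c) ^ 2 ∂(ymSpecification ρ β {e} ω) := by
  classical
  obtain ⟨κ, β₀, hκ, hβ₀, hker⟩ := kernel_variance_floor ρ hρ hinj hU hD θ hθ m₀
  refine ⟨κ, β₀, hκ, hβ₀, fun β hβ d p e ω hep hcard hS hmean c => ?_⟩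
  have hpe : p ∈ plaquettesTouching {e} := mem_plaquettesTouching_singleton.2 hep
  have hFk := sub_plaquetteObs_update_eq_linkCost ρ hU hep ω
  have hk'0 : linkCost ρ (fun _ : Unit => staple p e ω) (ω e) ≤ θ / β := by
    have h := hFk (ω e)
    rw [Function.update_eq_self, add_zero] at h
    rw [← h]
    exact (sub_plaquetteObs_le_linkAction ρ hU hep ω).trans hS
  exact hker β hβ e ω ⟨p, hpe⟩ hcard Unit (fun _ : Unit => staple p e ω) (by simpa using hm₀)
    (fun U => (N : ℝ) - plaquetteObs ρ p.1 p.2.1.1 p.2.1.2 U) 0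
    (measurable_const.sub (continuous_plaquetteObs ρ hρ _ _ _).measurable) hFk hS hk'0 hmean c

end Kernel

/-! ## §2 Torus plumbing: windows, good exteriors, integration of a kernel floor -/

section Plumbing

variable (G : Type) [Group G] [TopologicalSpace G] [IsTopologicalGroup G] [CompactSpace G]
  [MeasurableSpace G] [BorelSpace G] (r : LatticeRep G)

omit [TopologicalSpace G] [IsTopologicalGroup G] [CompactSpace G] [MeasurableSpace G] [BorelSpace G] in
/-- **Window**: the link `e = (x, i)` and every edge of a plaquette through it lie, with margin one, in the coordinate window
of width `2L+1 ≥ 5` starting at `x − 2`. [folklore] -/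
theorem window_of_touching {L : ℕ} (hL : 2 ≤ L) (x : Fin 4 → ℤ) (i : Fin 4) :
    ∀ e' ∈ ({((x, i) : ZdEdge 4)} : Finset (ZdEdge 4)) ∪ (plaquettesTouching {((x, i) : ZdEdge 4)}).biUnion plaquetteEdges,
      ∀ j, (x j - 2) + 1 ≤ e'.1 j ∧ e'.1 j + 2 ≤ (x j - 2) + ((2 * L + 1 : ℕ) : ℤ) := by
  intro e' he' j
  have hT : (5 : ℤ) ≤ ((2 * L + 1 : ℕ) : ℤ) := by push_cast; omega
  rcases Finset.mem_union.1 he' with h1 | h2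
  · rw [Finset.mem_singleton] at h1
    subst h1
    exact ⟨by show x j - 2 + 1 ≤ x j; omega, by show x j + 2 ≤ x j - 2 + ((2 * L + 1 : ℕ) : ℤ); omega⟩
  · obtain ⟨e'', he'', hnear⟩ := exists_near_of_mem_plaquetteEdges_touching h2
    rw [Finset.mem_singleton] at he''
    subst he''
    obtain ⟨h3, h4⟩ := hnear j
    dsimp only at h3 h4
    exact ⟨by omega, by omega⟩

omit [IsTopologicalGroup G] [CompactSpace G] [MeasurableSpace G] [BorelSpace G] in
/-- The link action `S_e` is non-negative (each plaquette cost is). [folklore] -/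
theorem wilsonBoundaryAction_singleton_nonneg (e : ZdEdge 4) (U : LGConfig 4 G) :
    0 ≤ wilsonBoundaryAction r.ρ {e} U := by
  refine Finset.sum_nonneg fun p' _ => ?_
  have h := abs_le.1 (abs_plaquetteObs_le_holds r.ρ r.mem_unitary p'.1 p'.2.1.1 p'.2.1.2 U)
  linarith [h.2]

set_option maxHeartbeats 400000 in
/-- **THE GOOD EXTERIORS ARE TYPICAL.**  There is `θ > 0` (depending on `(G, r)`: `θ = 24K + 1` with g28's sharp one-point
constant) such that on every odd torus `2L+1 ≥ 5`, at every `β ≥ 4`, for every link `e = (x, i)`, the set of torus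
configurations whose periodic lift has `S_e ≤ θ/β` AND one-link kernel mean `∫ S_e dγ_e(·|lift) ≤ θ/β` has probability `≥ 1/2`
(torus DLR for `S_e` and Markov's inequality, twice). [folklore] -/
theorem exists_good_exteriors :
    ∃ θ : ℝ, 0 < θ ∧ ∀ (L : ℕ), 2 ≤ L → ∀ β : ℝ, 4 ≤ β → ∀ (x : Fin 4 → ℤ) (i : Fin 4),
      1 / 2 ≤ (wilsonMeasure (d := 4) (L := 2 * L + 1) r.ρ β).real
        {U | wilsonBoundaryAction r.ρ {((x, i) : ZdEdge 4)} (torusLift (2 * L + 1) U) ≤ θ / β ∧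
          ∫ V, wilsonBoundaryAction r.ρ {((x, i) : ZdEdge 4)} V
              ∂(ymSpecification r.ρ β {((x, i) : ZdEdge 4)} (torusLift (2 * L + 1) U)) ≤ θ / β} := by
  classical
  haveI := r.secondCountableTopology
  obtain ⟨K, hK0, hK⟩ := Summit.QuantumFields.YangMills.Cruxes.NT.SharpCeilings.exists_plaquetteCost_moments_le_sharp G r
  refine ⟨24 * K + 1, by linarith, fun L hL β hβ x i => ?_⟩
  haveI : NeZero (2 * L + 1) := ⟨by omega⟩
  have hβ0 : 0 < β := by linarith
  have hL1 : 1 ≤ L := le_trans one_le_two hL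
  set θ : ℝ := 24 * K + 1 with hθ
  set μT := wilsonMeasure (d := 4) (L := 2 * L + 1) (G := G) r.ρ β with hμT
  haveI : IsProbabilityMeasure μT := isProbabilityMeasure_wilsonMeasure (d := 4) (L := 2 * L + 1) r.ρ r.continuous β
  set e : ZdEdge 4 := (x, i) with he
  set Se : LGConfig 4 G → ℝ := wilsonBoundaryAction r.ρ {e} with hSe
  have hSecont : Continuous Se := continuous_wilsonBoundaryAction r.ρ r.continuous {e}
  have hSebd := abs_wilsonBoundaryAction_singleton_le r.ρ r.mem_unitary e
  set kerS : LGConfig 4 G → ℝ := fun ω => ∫ V, Se V ∂(ymSpecification r.ρ β {e} ω) with hkerS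
  have hkerScont : Continuous kerS := continuous_integral_ymSpecification r.ρ r.continuous β {e} hSecont hSebd
  show 1 / 2 ≤ μT.real {U | Se (torusLift (2 * L + 1) U) ≤ θ / β ∧ kerS (torusLift (2 * L + 1) U) ≤ θ / β}
  set Good : Set (GaugeConfig 4 (2 * L + 1) G) :=
    {U | Se (torusLift (2 * L + 1) U) ≤ θ / β ∧ kerS (torusLift (2 * L + 1) U) ≤ θ / β} with hGood
  have hGoodm : MeasurableSet Good :=
    ((isClosed_le (hSecont.comp (continuous_torusLift _)) continuous_const).inter
      (isClosed_le (hkerScont.comp (continuous_torusLift _)) continuous_const)).measurableSet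
  -- the torus mean of `S_e ∘ lift` is `≤ 6K/β`
  obtain ⟨j, hj⟩ : ∃ j : Fin 4, j ≠ i := by
    by_cases h : i = 0
    · exact ⟨1, by rw [h]; decide⟩
    · exact ⟨0, fun h' => h h'.symm⟩
  obtain ⟨q, hq⟩ : ∃ q : {q : Fin 4 × Fin 4 // q.1 < q.2}, True := by
    rcases lt_or_gt_of_ne hj with hlt | hgt
    · exact ⟨⟨(j, i), hlt⟩, trivial⟩
    · exact ⟨⟨(i, j), hgt⟩, trivial⟩
  set qT : Plaquette 4 (2 * L + 1) := (Literature.Probability.LatticeModels.Torus.proj (2 * L + 1) x, q) with hqT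
  have hES : ∫ U, Se (torusLift (2 * L + 1) U) ∂μT ≤ 6 * K / β := by
    have h1 := torusE_linkAction_eq_card_mul G r β L e qT
    unfold Summit.QuantumFields.YangMills.Cruxes.OSLegsFromFemtoAndGap.DlrCollarTransfer.torusE at h1
    rw [hSe, h1]
    have hq1 := (hK L hL1 β hβ qT).1
    have hc : ((plaquettesTouching {e}).card : ℝ) ≤ 6 := by
      exact_mod_cast (card_plaquettesTouching_singleton_le e).trans (by norm_num)
    have hI0 : 0 ≤ ∫ U, plaquetteCost r.ρ U qT ∂μT := integral_nonneg fun U => by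
      have h := abs_le.1 (abs_plaqRe_le r.ρ r.continuous U qT)
      change 0 ≤ (r.N : ℝ) - plaqRe r.ρ U qT
      linarith [h.2]
    calc ((plaquettesTouching {e}).card : ℝ) * ∫ U, plaquetteCost r.ρ U qT ∂μT ≤ 6 * (K / β) :=
          mul_le_mul hc hq1 hI0 (by norm_num)
      _ = 6 * K / β := by ring
  have hESint : Integrable (fun U => Se (torusLift (2 * L + 1) U)) μT :=
    Integrable.of_mem_Icc (-(((2 * (4 - 1) : ℕ) : ℝ) * (2 * (r.N : ℝ)))) (((2 * (4 - 1) : ℕ) : ℝ) * (2 * (r.N : ℝ)))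
      (hSecont.comp (continuous_torusLift _)).measurable.aemeasurable (ae_of_all _ fun U => abs_le.1 (hSebd _))
  have hES0 : ∀ U, 0 ≤ Se (torusLift (2 * L + 1) U) := fun U =>
    wilsonBoundaryAction_singleton_nonneg G r e _
  -- the kernel mean has the same torus mean (DLR) and is non-negative
  have hEker : ∫ U, kerS (torusLift (2 * L + 1) U) ∂μT = ∫ U, Se (torusLift (2 * L + 1) U) ∂μT :=
    (integral_torusLift_eq_integral_kernel r.ρ r.continuous β {e} hSecont hSebd
      (isCylinder_wilsonBoundaryAction_holds r.ρ {e}) (2 * L + 1) (fun j => x j - 2) (window_of_touching hL x i)).symm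
  have hker0 : ∀ U, 0 ≤ kerS (torusLift (2 * L + 1) U) := by
    intro U
    haveI := isProbabilityMeasure_ymSpecification r.ρ r.continuous β {e} (torusLift (2 * L + 1) U)
    exact integral_nonneg fun V => wilsonBoundaryAction_singleton_nonneg G r e V
  have hkerint : Integrable (fun U => kerS (torusLift (2 * L + 1) U)) μT :=
    Integrable.of_mem_Icc (-(((2 * (4 - 1) : ℕ) : ℝ) * (2 * (r.N : ℝ)))) (((2 * (4 - 1) : ℕ) : ℝ) * (2 * (r.N : ℝ)))
      (hkerScont.comp (continuous_torusLift _)).measurable.aemeasurable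
      (ae_of_all _ fun U => abs_le.1 (abs_integral_ymSpecification_le r.ρ r.continuous β {e} hSebd _))
  -- Markov twice
  have hMarkov : ∀ {f : GaugeConfig 4 (2 * L + 1) G → ℝ}, (∀ U, 0 ≤ f U) → Integrable f μT →
      ∫ U, f U ∂μT ≤ 6 * K / β → μT.real {U | θ / β ≤ f U} ≤ 1 / 4 := by
    intro f hf0 hfi hfE
    have hM := mul_meas_ge_le_integral_of_nonneg (μ := μT) (ae_of_all _ hf0) hfi (θ / β)
    have h1 : θ / β * μT.real {U | θ / β ≤ f U} ≤ 6 * K / β := hM.trans hfE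
    have h2 : θ * μT.real {U | θ / β ≤ f U} ≤ 6 * K := by
      have := mul_le_mul_of_nonneg_left h1 hβ0.le
      have e1 : β * (θ / β * μT.real {U | θ / β ≤ f U}) = θ * μT.real {U | θ / β ≤ f U} := by field_simp
      have e2 : β * (6 * K / β) = 6 * K := by field_simp
      linarith
    rw [hθ] at h2
    nlinarith [measureReal_nonneg (μ := μT) (s := {U | θ / β ≤ f U})]
  have hA4 := hMarkov hES0 hESint hES
  have hB4 := hMarkov hker0 hkerint (hEker.le.trans hES)
  have hsub : Goodᶜ ⊆ {U | θ / β ≤ Se (torusLift (2 * L + 1) U)} ∪ {U | θ / β ≤ kerS (torusLift (2 * L + 1) U)} := by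
    intro U hU
    rw [Set.mem_compl_iff, hGood, Set.mem_setOf_eq, not_and_or] at hU
    rcases hU with h | h
    · exact Or.inl (le_of_lt (not_le.1 h))
    · exact Or.inr (le_of_lt (not_le.1 h))
  have h1 := (measureReal_mono (μ := μT) hsub).trans
    (measureReal_union_le {U | θ / β ≤ Se (torusLift (2 * L + 1) U)} {U | θ / β ≤ kerS (torusLift (2 * L + 1) U)})
  have h2 : μT.real Goodᶜ = 1 - μT.real Good := by rw [measureReal_compl hGoodm, probReal_univ]
  linarith

/-- **A kernel floor on the good exteriors integrates to a torus floor.**  If a bounded continuous cylinder observable `F` of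
`ℤ⁴`, supported with margin in the window of the torus, has one-link kernel variance `≥ κ/β²` about the centre `c` at every
exterior in a set `Good` of torus probability `≥ 1/2`, then `κ/(2β²) ≤ ∫ (F ∘ lift − c)² dμ_{T,β}` (torus DLR at the link
+ positivity of the kernel integrals elsewhere). [folklore] -/
theorem torus_integral_ge_of_good {β : ℝ} {L : ℕ} [NeZero (2 * L + 1)] (e : ZdEdge 4) {F : LGConfig 4 G → ℝ}
    (hF : Continuous F) {B : ℝ} (hB : ∀ U, |F U| ≤ B) {S₀ : Finset (ZdEdge 4)} (hFS : IsCylinder F S₀)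
    (lo : Fin 4 → ℤ) (hwin : ∀ e' ∈ ({e} : Finset (ZdEdge 4)) ∪ S₀, ∀ j, lo j + 1 ≤ e'.1 j ∧ e'.1 j + 2 ≤ lo j + (2 * L + 1 : ℕ))
    (c : ℝ) (hc : |c| ≤ B) {κ : ℝ} (hκ : 0 ≤ κ) {Good : Set (GaugeConfig 4 (2 * L + 1) G)} (hGm : MeasurableSet Good)
    (hGood : 1 / 2 ≤ (wilsonMeasure (d := 4) (L := 2 * L + 1) r.ρ β).real Good)
    (hfloor : ∀ U ∈ Good, κ / β ^ 2 ≤ ∫ V, (F V - c) ^ 2 ∂(ymSpecification r.ρ β {e} (torusLift (2 * L + 1) U))) :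
    κ / 2 / β ^ 2 ≤ ∫ U, (F (torusLift (2 * L + 1) U) - c) ^ 2 ∂(wilsonMeasure (d := 4) (L := 2 * L + 1) r.ρ β) := by
  haveI := r.secondCountableTopology
  set μT := wilsonMeasure (d := 4) (L := 2 * L + 1) (G := G) r.ρ β with hμT
  haveI : IsProbabilityMeasure μT := isProbabilityMeasure_wilsonMeasure (d := 4) (L := 2 * L + 1) r.ρ r.continuous β
  set Fc : LGConfig 4 G → ℝ := fun U => (F U - c) ^ 2 with hFc
  have hFccont : Continuous Fc := (hF.sub continuous_const).pow 2
  have hFcbd : ∀ U, |Fc U| ≤ (2 * B) ^ 2 := by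
    intro U
    rw [hFc, abs_of_nonneg (sq_nonneg _)]
    have h1 := abs_le.1 (hB U)
    have h2 := abs_le.1 hc
    have h3 : |F U - c| ≤ 2 * B := by rw [abs_le]; constructor <;> linarith
    calc (F U - c) ^ 2 = |F U - c| ^ 2 := (sq_abs _).symm
      _ ≤ (2 * B) ^ 2 := pow_le_pow_left₀ (abs_nonneg _) h3 2
  have hFccyl : IsCylinder Fc S₀ := by
    intro U V h
    simp only [hFc]
    rw [hFS h]
  have hDLR := integral_torusLift_eq_integral_kernel r.ρ r.continuous β {e} hFccont hFcbd hFccyl (2 * L + 1) lo hwin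
  show κ / 2 / β ^ 2 ≤ ∫ U, Fc (torusLift (2 * L + 1) U) ∂μT
  rw [hDLR]
  set inner : GaugeConfig 4 (2 * L + 1) G → ℝ :=
    fun U => ∫ V, Fc V ∂(ymSpecification r.ρ β {e} (torusLift (2 * L + 1) U)) with hinner
  have hinner0 : ∀ U, 0 ≤ inner U := fun U => integral_nonneg fun V => sq_nonneg _
  have hinnerint : Integrable inner μT := by
    have hcont : Continuous inner :=
      (continuous_integral_ymSpecification r.ρ r.continuous β {e} hFccont hFcbd).comp (continuous_torusLift _)
    exact Integrable.of_mem_Icc (-((2 * B) ^ 2)) ((2 * B) ^ 2) hcont.measurable.aemeasurable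
      (ae_of_all _ fun U => abs_le.1 (abs_integral_ymSpecification_le r.ρ r.continuous β {e} hFcbd _))
  have hind : ∀ U, κ / β ^ 2 * Good.indicator (fun _ => (1 : ℝ)) U ≤ inner U := by
    intro U
    by_cases hU : U ∈ Good
    · rw [Set.indicator_of_mem hU, mul_one]; exact hfloor U hU
    · rw [Set.indicator_of_notMem hU, mul_zero]; exact hinner0 U
  have hint := integral_mono ((integrable_const (1 : ℝ)).indicator hGm |>.const_mul (κ / β ^ 2)) hinnerint hind
  rw [integral_const_mul, integral_indicator hGm, setIntegral_const, smul_eq_mul, mul_one] at hint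
  have hκβ : 0 ≤ κ / β ^ 2 := div_nonneg hκ (sq_nonneg _)
  calc κ / 2 / β ^ 2 = κ / β ^ 2 * (1 / 2) := by ring
    _ ≤ κ / β ^ 2 * μT.real Good := mul_le_mul_of_nonneg_left hGood hκβ
    _ ≤ ∫ U, inner U ∂μT := hint

end Plumbing
end Summit.QuantumFields.YangMills.Cruxes.NT.LinkEquipartition

end
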